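import Mathlib
import HarnessLib
import Summits.MatrixMultiplication.MatrixMultiplication.Theorems.OutsiderSandwichPencilBlocks

/-!
# OutsiderSandwich — pencil calculus for powers of the diagonalised CW tensor, II: pieces of the span law
(decomp-mm lens 4 «minimal-counterexample / extremal reduction», gen 38, kernel K38-2b; THESES-FREE,
DEFINITION-FREE — conventions of Part I: `hD`, `T_N(η) = contract3 (kroneckerPow D N) η`,
`η_a = fun v ↦ η (Fin.cons a v)`, `col M = LinearMap.range M.mulVecLin`)

The **2-pencil span law** `B(N)`: for independent covectors `ζ, ζ'` on words of length `N`,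
`2 · dim (col T_N(ζ) + col T_N(ζ')) ≥ 3 · 2^N`.  This file proves the pieces of the induction
`B(N) ⇒ B(N+1)` (assembled in Part IIc): `pair_bound` — `rank T_{N+1}(θ) ≥ 2 · dim (col T_N(θ_b) + col T_N(θ_c))`
(Roy's inequality on the block row / column of the third letter, whose diagonal block vanishes);
`rank_of_comps_ne_zero` — `B(N)` ⇒ every `θ` with all components non-zero has `rank T_{N+1}(θ) ≥ 3 · 2^N`
(independent pair of components ⇒ `pair_bound`; proportional components ⇒ product covector, Part I);
`exists_common_zero` (four points of `ℙ¹`, three letters), `dep_scalar` (proportional pairs);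
`mulVec_blockVec`, `caseA_bound`, `caseB_bound` — dimension counts for the two degenerate configurations of a
pencil with a common zero letter, by injective `coprod` maps of block-supported vectors.

References: [cite: CoppersmithWinograd1990, §6]; [cite: Roy1995, §1]; [cite: HornJohnson2013, §0.4];
[cite: BlaserIkenmeyerLysikovPandeySchreyer2019, §5].
-/

set_option linter.dupNamespace false

noncomputable section

namespace Summit.MatrixMultiplication.MatrixMultiplication.Theorems.OutsiderSandwichPencilSpan

open Literature.Computability.AlgebraicComplexity
open Summit.MatrixMultiplication.MatrixMultiplication.Theorems.OutsiderSandwichPencilBlocks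
open scoped Matrix BigOperators

variable {D : Fin 3 → Fin 3 → Fin 3 → ℂ} {N : ℕ}

/-! ## §0  Small tools -/

/-- The column space of `sA + tB` lies in `col A + col B`. [cite: HornJohnson2013, §0.4] -/
theorem range_comb_le {m n : Type*} [Fintype m] [Fintype n] (A B : Matrix m n ℂ) (s t : ℂ) :
    LinearMap.range (s • A + t • B).mulVecLin ≤ LinearMap.range A.mulVecLin ⊔ LinearMap.range B.mulVecLin := by
  rintro _ ⟨v, rfl⟩
  rw [Matrix.mulVecLin_apply, Matrix.add_mulVec, Matrix.smul_mulVec, Matrix.smul_mulVec]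
  exact Submodule.add_mem_sup (Submodule.smul_mem _ _ ⟨v, rfl⟩) (Submodule.smul_mem _ _ ⟨v, rfl⟩)

/-- `rank (sA + tB) ≤ dim (col A + col B)`. [cite: HornJohnson2013, §0.4] -/
theorem rank_comb_le {m n : Type*} [Fintype m] [Fintype n] (A B : Matrix m n ℂ) (s t : ℂ) :
    (s • A + t • B).rank ≤ Module.finrank ℂ ↥(LinearMap.range A.mulVecLin ⊔ LinearMap.range B.mulVecLin) :=
  Submodule.finrank_mono (range_comb_le A B s t)

/-- Components of a combination of covectors. [folklore] -/
theorem comp_comb (ζ ζ' : (Fin (N + 1) → Fin 3) → ℂ) (s t : ℂ) (d : Fin 3) :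
    (fun v : Fin N → Fin 3 => (s • ζ + t • ζ') (Fin.cons d v)) =
      s • (fun v => ζ (Fin.cons d v)) + t • (fun v => ζ' (Fin.cons d v)) := by
  funext v; simp

/-! ## §1  The pair bound and rank from non-vanishing components -/

/-- **Pair bound.**  For pairwise distinct `a, b, c`:
`2 · dim (col T_N(θ_b) + col T_N(θ_c)) ≤ rank T_{N+1}(θ)` — the block row `a` of `T_{N+1}(θ)` is
`[0 | T_N(θ_c) | T_N(θ_b)]` (up to order), the block column `a` is its transpose, and the block `(a,a)`
vanishes. [cite: Roy1995, §1] -/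
theorem pair_bound (hD : ∀ a b c, D a b c = if a ≠ b ∧ b ≠ c ∧ a ≠ c then 1 else 0) (N : ℕ)
    (θ : (Fin (N + 1) → Fin 3) → ℂ) {a b c : Fin 3} (hab : a ≠ b) (hbc : b ≠ c) (hac : a ≠ c) :
    2 * Module.finrank ℂ ↥(LinearMap.range (contract3 (kroneckerPow D N) (fun v => θ (Fin.cons b v))).mulVecLin ⊔
        LinearMap.range (contract3 (kroneckerPow D N) (fun v => θ (Fin.cons c v))).mulVecLin) ≤
      (contract3 (kroneckerPow D (N + 1)) θ).rank := by
  set T := contract3 (kroneckerPow D (N + 1)) θ with hT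
  have h1 := Literature.Barriers.Schanuel.rank_submatrix_add_rank_submatrix_le T
    (fun w : Fin N → Fin 3 => (Fin.cons a w : Fin (N + 1) → Fin 3)) id id
    (fun w : Fin N → Fin 3 => (Fin.cons a w : Fin (N + 1) → Fin 3))
    (fun i j => by rw [hT]; exact slice_succ_diag hD N θ a i j)
  set R := T.submatrix (fun w : Fin N → Fin 3 => (Fin.cons a w : Fin (N + 1) → Fin 3)) id with hR
  set C := T.submatrix id (fun w : Fin N → Fin 3 => (Fin.cons a w : Fin (N + 1) → Fin 3)) with hC
  have hCR : C = Rᵀ := by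
    rw [hR, Matrix.transpose_submatrix, hT, slice_transpose hD]
  have hrank : C.rank = R.rank := by rw [hCR, Matrix.rank_transpose]
  have hRT : ∀ (y : (Fin (N + 1) → Fin 3) → ℂ) (w : Fin N → Fin 3), (R *ᵥ y) w = (T *ᵥ y) (Fin.cons a w) :=
    fun _ _ => rfl
  have hsubB : LinearMap.range (contract3 (kroneckerPow D N) (fun v => θ (Fin.cons b v))).mulVecLin ≤
      LinearMap.range R.mulVecLin := by
    rintro _ ⟨x, rfl⟩
    refine ⟨fun g => if g 0 = c then x (Fin.tail g) else 0, ?_⟩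
    funext w
    rw [Matrix.mulVecLin_apply, Matrix.mulVecLin_apply, hRT, hT,
      slice_succ_mulVec_block hD N θ (Ne.symm hab) hac hbc]
  have hsubC : LinearMap.range (contract3 (kroneckerPow D N) (fun v => θ (Fin.cons c v))).mulVecLin ≤
      LinearMap.range R.mulVecLin := by
    rintro _ ⟨x, rfl⟩
    refine ⟨fun g => if g 0 = b then x (Fin.tail g) else 0, ?_⟩
    funext w
    rw [Matrix.mulVecLin_apply, Matrix.mulVecLin_apply, hRT, hT,
      slice_succ_mulVec_block hD N θ (Ne.symm hac) hab (Ne.symm hbc)]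
  have hle : Module.finrank ℂ ↥(LinearMap.range (contract3 (kroneckerPow D N) (fun v => θ (Fin.cons b v))).mulVecLin ⊔
      LinearMap.range (contract3 (kroneckerPow D N) (fun v => θ (Fin.cons c v))).mulVecLin) ≤ R.rank :=
    Submodule.finrank_mono (sup_le hsubB hsubC)
  omega

/-- **Rank from non-vanishing components** (given the span law one level down): if all three components
`θ_0, θ_1, θ_2` are non-zero then `rank T_{N+1}(θ) ≥ 3 · 2^N`. [cite: CoppersmithWinograd1990, §6] -/
theorem rank_of_comps_ne_zero (hD : ∀ a b c, D a b c = if a ≠ b ∧ b ≠ c ∧ a ≠ c then 1 else 0) (N : ℕ)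
    (ihB : ∀ ζ ζ' : (Fin N → Fin 3) → ℂ, LinearIndependent ℂ ![ζ, ζ'] →
      3 * 2 ^ N ≤ 2 * Module.finrank ℂ ↥(LinearMap.range (contract3 (kroneckerPow D N) ζ).mulVecLin ⊔
        LinearMap.range (contract3 (kroneckerPow D N) ζ').mulVecLin))
    (θ : (Fin (N + 1) → Fin 3) → ℂ) (hθ : ∀ a : Fin 3, (fun v : Fin N → Fin 3 => θ (Fin.cons a v)) ≠ 0) :
    3 * 2 ^ N ≤ (contract3 (kroneckerPow D (N + 1)) θ).rank := by
  by_cases h01 : LinearIndependent ℂ ![(fun v : Fin N → Fin 3 => θ (Fin.cons 0 v)),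
    (fun v : Fin N → Fin 3 => θ (Fin.cons 1 v))]
  · exact (ihB _ _ h01).trans (pair_bound hD N θ (a := 2) (b := 0) (c := 1) (by decide) (by decide) (by decide))
  by_cases h02 : LinearIndependent ℂ ![(fun v : Fin N → Fin 3 => θ (Fin.cons 0 v)),
    (fun v : Fin N → Fin 3 => θ (Fin.cons 2 v))]
  · exact (ihB _ _ h02).trans (pair_bound hD N θ (a := 1) (b := 0) (c := 2) (by decide) (by decide) (by decide))
  rw [LinearIndependent.pair_iff' (hθ 0)] at h01 h02
  push Not at h01 h02
  obtain ⟨s, hs⟩ := h01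
  obtain ⟨t, ht⟩ := h02
  have hs0 : s ≠ 0 := by
    rintro rfl; exact hθ 1 (by rw [← hs, zero_smul])
  have ht0 : t ≠ 0 := by
    rintro rfl; exact hθ 2 (by rw [← ht, zero_smul])
  have hcomp : ∀ (d : Fin 3) (v : Fin N → Fin 3), θ (Fin.cons d v) = ![1, s, t] d * θ (Fin.cons 0 v) := by
    intro d v
    have h1 := congr_fun hs v
    have h2 := congr_fun ht v
    simp only [Pi.smul_apply, smul_eq_mul] at h1 h2
    fin_cases d
    · simp
    · simpa using h1.symm
    · simpa using h2.symm
  have hθeq : θ = fun f => ![1, s, t] (f 0) * (fun v : Fin N → Fin 3 => θ (Fin.cons 0 v)) (Fin.tail f) := by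
    funext f
    conv_lhs => rw [← Fin.cons_self_tail f]
    exact hcomp (f 0) (Fin.tail f)
  have hlam : ∀ a : Fin 3, ![(1 : ℂ), s, t] a ≠ 0 := by
    intro a; fin_cases a <;> simp [hs0, ht0]
  rw [hθeq]
  calc 3 * 2 ^ N ≤ 3 * (contract3 (kroneckerPow D N) (fun v : Fin N → Fin 3 => θ (Fin.cons 0 v))).rank :=
        Nat.mul_le_mul_left 3 (two_pow_le_rank_slice hD N (hθ 0))
    _ ≤ _ := three_mul_rank_le_of_prod hD _ hlam _

/-! ## §2  Linear-algebra lemmas for pencils -/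

/-- **Common zero letter.**  If every member `s u + t u'` (`(s,t) ≠ 0`) of a pencil of letter-indexed
triples has a vanishing letter, one letter vanishes for `u` and `u'` simultaneously (the four points
`(1:0), (0:1), (1:1), (1:2)` of `ℙ¹` are pairwise independent; three letters). [folklore] -/
theorem exists_common_zero {V : Type*} [AddCommGroup V] [Module ℂ V] (u u' : Fin 3 → V)
    (h : ∀ s t : ℂ, s ≠ 0 ∨ t ≠ 0 → ∃ a, s • u a + t • u' a = 0) : ∃ a, u a = 0 ∧ u' a = 0 := by
  let P : Fin 4 → ℂ × ℂ := ![(1, 0), (0, 1), (1, 1), (1, 2)]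
  have hP : ∀ k, (P k).1 ≠ 0 ∨ (P k).2 ≠ 0 := by
    intro k; fin_cases k <;> simp [P]
  have hdet : ∀ i j : Fin 4, i ≠ j → (P i).1 * (P j).2 - (P j).1 * (P i).2 ≠ 0 := by
    intro i j hij
    fin_cases i <;> fin_cases j <;> simp_all [P] <;> norm_num
  choose f hf using fun k => h (P k).1 (P k).2 (hP k)
  obtain ⟨i, j, hij, hfij⟩ := Fintype.exists_ne_map_eq_of_card_lt f (by simp)
  have e1 := hf i
  have e2 := hf j
  rw [← hfij] at e2
  have hd := hdet i j hij
  refine ⟨f i, ?_, ?_⟩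
  · have key : ((P i).1 * (P j).2 - (P j).1 * (P i).2) • u (f i) =
        (P j).2 • ((P i).1 • u (f i) + (P i).2 • u' (f i)) - (P i).2 • ((P j).1 • u (f i) + (P j).2 • u' (f i)) := by
      module
    rw [e1, e2, smul_zero, smul_zero, sub_zero] at key
    exact (smul_eq_zero.mp key).resolve_left hd
  · have key : ((P i).1 * (P j).2 - (P j).1 * (P i).2) • u' (f i) =
        (P i).1 • ((P j).1 • u (f i) + (P j).2 • u' (f i)) - (P j).1 • ((P i).1 • u (f i) + (P i).2 • u' (f i)) := by
      module
    rw [e1, e2, smul_zero, smul_zero, sub_zero] at key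
    exact (smul_eq_zero.mp key).resolve_left hd

/-- **Proportional pairs.**  If `x, x'` are independent and every pair `(s x + t x', s y + t y')` is
dependent, then `y = r x` and `y' = r x'` for a single scalar `r`. [folklore] -/
theorem dep_scalar {V : Type*} [AddCommGroup V] [Module ℂ V] {x x' y y' : V} (hx : LinearIndependent ℂ ![x, x'])
    (h : ∀ s t : ℂ, ¬ LinearIndependent ℂ ![s • x + t • x', s • y + t • y']) :
    ∃ r : ℂ, y = r • x ∧ y' = r • x' := by
  have hx0 : x ≠ 0 := by simpa using hx.ne_zero 0
  have hx'0 : x' ≠ 0 := by simpa using hx.ne_zero 1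
  have hxx' : x + x' ≠ 0 := by
    intro h0
    have := (LinearIndependent.pair_iff.mp hx) 1 1 (by simpa using h0)
    simp at this
  have d10 := h 1 0
  have d01 := h 0 1
  have d11 := h 1 1
  simp only [one_smul, zero_smul, add_zero, zero_add] at d10 d01 d11
  rw [LinearIndependent.pair_iff' hx0] at d10
  rw [LinearIndependent.pair_iff' hx'0] at d01
  rw [LinearIndependent.pair_iff' hxx'] at d11
  push Not at d10 d01 d11
  obtain ⟨t₁, ht₁⟩ := d10
  obtain ⟨t₂, ht₂⟩ := d01
  obtain ⟨t₃, ht₃⟩ := d11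
  have hrel : (t₃ - t₁) • x + (t₃ - t₂) • x' = 0 := by
    have h0 : t₃ • (x + x') - (t₁ • x + t₂ • x') = 0 := by rw [ht₃, ht₁, ht₂, sub_self]
    calc (t₃ - t₁) • x + (t₃ - t₂) • x' = t₃ • (x + x') - (t₁ • x + t₂ • x') := by module
      _ = 0 := h0
  obtain ⟨h31, h32⟩ := (LinearIndependent.pair_iff.mp hx) _ _ hrel
  refine ⟨t₃, ?_, ?_⟩
  · rw [← ht₁, sub_eq_zero.mp h31]
  · rw [← ht₂, sub_eq_zero.mp h32]

/-! ## §3  Block-supported vectors and the two degenerate configurations -/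

/-- **Action on a block vector, vector form**: for pairwise distinct `a, b, c`,
`T_{N+1}(ξ) x^{(c)} = (T_N(ξ_b) x)^{(a)} + (T_N(ξ_a) x)^{(b)}`. [folklore] -/
theorem mulVec_blockVec (hD : ∀ a b c, D a b c = if a ≠ b ∧ b ≠ c ∧ a ≠ c then 1 else 0) (N : ℕ)
    (ξ : (Fin (N + 1) → Fin 3) → ℂ) {a b c : Fin 3} (hab : a ≠ b) (hbc : b ≠ c) (hac : a ≠ c)
    (x : (Fin N → Fin 3) → ℂ) :
    contract3 (kroneckerPow D (N + 1)) ξ *ᵥ (fun g : Fin (N + 1) → Fin 3 => if g 0 = c then x (Fin.tail g) else 0) =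
      (fun g : Fin (N + 1) → Fin 3 => if g 0 = a then
          (contract3 (kroneckerPow D N) (fun v => ξ (Fin.cons b v)) *ᵥ x) (Fin.tail g) else 0) +
      (fun g : Fin (N + 1) → Fin 3 => if g 0 = b then
          (contract3 (kroneckerPow D N) (fun v => ξ (Fin.cons a v)) *ᵥ x) (Fin.tail g) else 0) := by
  funext g
  obtain ⟨d, v, rfl⟩ : ∃ d v, g = Fin.cons d v := ⟨g 0, Fin.tail g, (Fin.cons_self_tail g).symm⟩
  simp only [Pi.add_apply, Fin.cons_zero, Fin.tail_cons]
  rcases eq_or_ne d a with rfl | hd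
  · rw [slice_succ_mulVec_block hD N ξ (Ne.symm hab) hac hbc x v]
    simp [hab]
  rcases letter_eq_or a d b c hab hbc hac hd with rfl | rfl
  · rw [slice_succ_mulVec_block hD N ξ hab hbc hac x v]
    simp [Ne.symm hab]
  · rw [slice_succ_mulVec_block_diag hD N ξ _ x v]
    simp [Ne.symm hac, Ne.symm hbc]

/-- **Configuration A.**  Common zero letter `a` and proportional `c`-components (`ζ_c = r ζ_b`,
`ζ'_c = r ζ'_b`): `dim (col T(ζ) + col T(ζ')) ≥ 2 · dim (col T_N(ζ_b) + col T_N(ζ'_b))` — the vectors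
`w^{(a)}` and `(r w)^{(b)} + w^{(c)}`, `w ∈ col T_N(ζ_b) + col T_N(ζ'_b)`, lie in the joint column space and
form two independent copies. [cite: HornJohnson2013, §0.4] -/
theorem caseA_bound (hD : ∀ a b c, D a b c = if a ≠ b ∧ b ≠ c ∧ a ≠ c then 1 else 0) (N : ℕ)
    {a b c : Fin 3} (hab : a ≠ b) (hbc : b ≠ c) (hac : a ≠ c) (ζ ζ' : (Fin (N + 1) → Fin 3) → ℂ) (r : ℂ)
    (hζa : (fun v : Fin N → Fin 3 => ζ (Fin.cons a v)) = 0)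
    (hζ'a : (fun v : Fin N → Fin 3 => ζ' (Fin.cons a v)) = 0)
    (hζc : (fun v : Fin N → Fin 3 => ζ (Fin.cons c v)) = r • (fun v => ζ (Fin.cons b v)))
    (hζ'c : (fun v : Fin N → Fin 3 => ζ' (Fin.cons c v)) = r • (fun v => ζ' (Fin.cons b v))) :
    2 * Module.finrank ℂ ↥(LinearMap.range (contract3 (kroneckerPow D N) (fun v => ζ (Fin.cons b v))).mulVecLin ⊔
        LinearMap.range (contract3 (kroneckerPow D N) (fun v => ζ' (Fin.cons b v))).mulVecLin) ≤
      Module.finrank ℂ ↥(LinearMap.range (contract3 (kroneckerPow D (N + 1)) ζ).mulVecLin ⊔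
        LinearMap.range (contract3 (kroneckerPow D (N + 1)) ζ').mulVecLin) := by
  set W := LinearMap.range (contract3 (kroneckerPow D N) (fun v => ζ (Fin.cons b v))).mulVecLin ⊔
    LinearMap.range (contract3 (kroneckerPow D N) (fun v => ζ' (Fin.cons b v))).mulVecLin with hW
  set V := LinearMap.range (contract3 (kroneckerPow D (N + 1)) ζ).mulVecLin ⊔
    LinearMap.range (contract3 (kroneckerPow D (N + 1)) ζ').mulVecLin with hV
  -- block embeddings `x ↦ x^{(d)}`
  let E : Fin 3 → (((Fin N → Fin 3) → ℂ) →ₗ[ℂ] ((Fin (N + 1) → Fin 3) → ℂ)) := fun d =>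
    { toFun := fun x g => if g 0 = d then x (Fin.tail g) else 0
      map_add' := fun x y => by
        funext g; by_cases h : g 0 = d <;> simp [h]
      map_smul' := fun s x => by
        funext g; by_cases h : g 0 = d <;> simp [h] }
  have hEf : ∀ d x, (E d x : (Fin (N + 1) → Fin 3) → ℂ) = fun g => if g 0 = d then x (Fin.tail g) else 0 :=
    fun _ _ => rfl
  have hE : ∀ (d d' : Fin 3) (x : (Fin N → Fin 3) → ℂ) (v : Fin N → Fin 3),
      E d x (Fin.cons d' v) = if d' = d then x v else 0 := by
    intro d d' x v; rw [hEf]; simp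
  -- the block identities: for `ξ ∈ {ζ, ζ'}`, `E a (T_N ξ_b x) = T ξ (E c x)` and
  -- `(r • E b + E c) (T_N ξ_b x) = T ξ (E a x)`
  have hblk : ∀ ξ : (Fin (N + 1) → Fin 3) → ℂ, (fun v : Fin N → Fin 3 => ξ (Fin.cons a v)) = 0 →
      (fun v : Fin N → Fin 3 => ξ (Fin.cons c v)) = r • (fun v => ξ (Fin.cons b v)) →
      ∀ x, (E a (contract3 (kroneckerPow D N) (fun v => ξ (Fin.cons b v)) *ᵥ x) =
          contract3 (kroneckerPow D (N + 1)) ξ *ᵥ E c x) ∧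
        ((r • E b + E c) (contract3 (kroneckerPow D N) (fun v => ξ (Fin.cons b v)) *ᵥ x) =
          contract3 (kroneckerPow D (N + 1)) ξ *ᵥ E a x) := by
    intro ξ hξa hξc x
    constructor
    · rw [hEf, hEf, mulVec_blockVec hD N ξ hab hbc hac x, hξa, slice_zero, Matrix.zero_mulVec]
      funext g; simp
    · rw [LinearMap.add_apply, LinearMap.smul_apply, hEf, hEf, hEf,
        mulVec_blockVec hD N ξ hbc (Ne.symm hac) (Ne.symm hab) x, hξc, slice_smul, Matrix.smul_mulVec]
      funext g; simp [add_comm]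
  -- the comparison map
  let L : (↥W × ↥W) →ₗ[ℂ] ((Fin (N + 1) → Fin 3) → ℂ) :=
    ((E a).comp W.subtype).coprod ((r • E b + E c).comp W.subtype)
  have hLapply : ∀ p : ↥W × ↥W, L p = E a (p.1 : (Fin N → Fin 3) → ℂ) + (r • E b + E c) (p.2 : (Fin N → Fin 3) → ℂ) := by
    intro p; simp [L]
  have hLinj : Function.Injective L := by
    intro p q hpq
    have h1 : ∀ v, (p.1 : (Fin N → Fin 3) → ℂ) v = (q.1 : (Fin N → Fin 3) → ℂ) v := fun v => by
      have := congr_fun hpq (Fin.cons a v)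
      simpa [hLapply, hE, hab, hac] using this
    have h2 : ∀ v, (p.2 : (Fin N → Fin 3) → ℂ) v = (q.2 : (Fin N → Fin 3) → ℂ) v := fun v => by
      have := congr_fun hpq (Fin.cons c v)
      simpa [hLapply, hE, Ne.symm hac, Ne.symm hbc] using this
    exact Prod.ext (Subtype.ext (funext h1)) (Subtype.ext (funext h2))
  -- its range lies in `V`
  have hmemW : ∀ w ∈ W, E a w ∈ V ∧ (r • E b + E c) w ∈ V := by
    intro w hw
    obtain ⟨y, hy, z, hz, rfl⟩ := Submodule.mem_sup.mp hw
    obtain ⟨x, rfl⟩ := hy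
    obtain ⟨x', rfl⟩ := hz
    simp only [Matrix.mulVecLin_apply, map_add]
    obtain ⟨h1, h2⟩ := hblk ζ hζa hζc x
    obtain ⟨h1', h2'⟩ := hblk ζ' hζ'a hζ'c x'
    constructor
    · exact Submodule.add_mem_sup (h1 ▸ ⟨E c x, rfl⟩) (h1' ▸ ⟨E c x', rfl⟩)
    · exact Submodule.add_mem_sup (h2 ▸ ⟨E a x, rfl⟩) (h2' ▸ ⟨E a x', rfl⟩)
  have hrange : LinearMap.range L ≤ V := by
    rintro _ ⟨p, rfl⟩
    rw [hLapply]
    exact V.add_mem (hmemW _ p.1.2).1 (hmemW _ p.2.2).2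
  have key : Module.finrank ℂ (↥W × ↥W) ≤ Module.finrank ℂ ↥V := by
    rw [← LinearMap.finrank_range_of_inj hLinj]
    exact Submodule.finrank_mono hrange
  rw [Module.finrank_prod] at key
  omega

/-- **Configuration B.**  Common zero letter `a`, and two members `θ¹ = e_c ⊗ ξ¹`, `θ² = e_b ⊗ ξ²` of the
pencil (`θ¹_a = θ¹_b = 0`, `θ²_c = 0`): the joint column space contains the three block-disjoint pieces
`(col T_N(ξ¹))^{(b)}`, `(col T_N(ξ¹))^{(a)}`, `(col T_N(ξ²))^{(c)}`. [cite: HornJohnson2013, §0.4] -/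
theorem caseB_bound (hD : ∀ a b c, D a b c = if a ≠ b ∧ b ≠ c ∧ a ≠ c then 1 else 0) (N : ℕ)
    {a b c : Fin 3} (hab : a ≠ b) (hbc : b ≠ c) (hac : a ≠ c) (θ₁ θ₂ : (Fin (N + 1) → Fin 3) → ℂ)
    (h1a : (fun v : Fin N → Fin 3 => θ₁ (Fin.cons a v)) = 0)
    (h1b : (fun v : Fin N → Fin 3 => θ₁ (Fin.cons b v)) = 0)
    (h2c : (fun v : Fin N → Fin 3 => θ₂ (Fin.cons c v)) = 0) :
    2 * (contract3 (kroneckerPow D N) (fun v => θ₁ (Fin.cons c v))).rank +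
        (contract3 (kroneckerPow D N) (fun v => θ₂ (Fin.cons b v))).rank ≤
      Module.finrank ℂ ↥(LinearMap.range (contract3 (kroneckerPow D (N + 1)) θ₁).mulVecLin ⊔
        LinearMap.range (contract3 (kroneckerPow D (N + 1)) θ₂).mulVecLin) := by
  set V := LinearMap.range (contract3 (kroneckerPow D (N + 1)) θ₁).mulVecLin ⊔
    LinearMap.range (contract3 (kroneckerPow D (N + 1)) θ₂).mulVecLin with hV
  let E : Fin 3 → (((Fin N → Fin 3) → ℂ) →ₗ[ℂ] ((Fin (N + 1) → Fin 3) → ℂ)) := fun d =>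
    { toFun := fun x g => if g 0 = d then x (Fin.tail g) else 0
      map_add' := fun x y => by
        funext g; by_cases h : g 0 = d <;> simp [h]
      map_smul' := fun s x => by
        funext g; by_cases h : g 0 = d <;> simp [h] }
  have hEf : ∀ d x, (E d x : (Fin (N + 1) → Fin 3) → ℂ) = fun g => if g 0 = d then x (Fin.tail g) else 0 :=
    fun _ _ => rfl
  have hE : ∀ (d d' : Fin 3) (x : (Fin N → Fin 3) → ℂ) (v : Fin N → Fin 3),
      E d x (Fin.cons d' v) = if d' = d then x v else 0 := by
    intro d d' x v; rw [hEf]; simp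
  -- block identities
  have hb1 : ∀ x, E b (contract3 (kroneckerPow D N) (fun v => θ₁ (Fin.cons c v)) *ᵥ x) =
      contract3 (kroneckerPow D (N + 1)) θ₁ *ᵥ E a x := by
    intro x
    rw [hEf, hEf, mulVec_blockVec hD N θ₁ hbc (Ne.symm hac) (Ne.symm hab) x, h1b, slice_zero,
      Matrix.zero_mulVec]
    funext g; simp
  have ha1 : ∀ x, E a (contract3 (kroneckerPow D N) (fun v => θ₁ (Fin.cons c v)) *ᵥ x) =
      contract3 (kroneckerPow D (N + 1)) θ₁ *ᵥ E b x := by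
    intro x
    rw [hEf, hEf, mulVec_blockVec hD N θ₁ hac (Ne.symm hbc) hab x, h1a, slice_zero, Matrix.zero_mulVec]
    funext g; simp
  have hc2 : ∀ x, E c (contract3 (kroneckerPow D N) (fun v => θ₂ (Fin.cons b v)) *ᵥ x) =
      contract3 (kroneckerPow D (N + 1)) θ₂ *ᵥ E a x := by
    intro x
    rw [hEf, hEf, mulVec_blockVec hD N θ₂ hbc (Ne.symm hac) (Ne.symm hab) x, h2c, slice_zero,
      Matrix.zero_mulVec]
    funext g; simp
  set X₁ := contract3 (kroneckerPow D N) (fun v => θ₁ (Fin.cons c v)) with hX₁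
  set X₂ := contract3 (kroneckerPow D N) (fun v => θ₂ (Fin.cons b v)) with hX₂
  set C₁ := LinearMap.range X₁.mulVecLin with hC₁
  set C₂ := LinearMap.range X₂.mulVecLin with hC₂
  let L : (↥C₁ × (↥C₁ × ↥C₂)) →ₗ[ℂ] ((Fin (N + 1) → Fin 3) → ℂ) :=
    ((E b).comp C₁.subtype).coprod (((E a).comp C₁.subtype).coprod ((E c).comp C₂.subtype))
  have hLapply : ∀ p : ↥C₁ × (↥C₁ × ↥C₂), L p = E b (p.1 : (Fin N → Fin 3) → ℂ) +
      (E a (p.2.1 : (Fin N → Fin 3) → ℂ) + E c (p.2.2 : (Fin N → Fin 3) → ℂ)) := by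
    intro p; simp [L]
  have hLinj : Function.Injective L := by
    intro p q hpq
    have h1 : ∀ v, (p.1 : (Fin N → Fin 3) → ℂ) v = (q.1 : (Fin N → Fin 3) → ℂ) v := fun v => by
      have := congr_fun hpq (Fin.cons b v)
      simpa [hLapply, hE, Ne.symm hab, hbc] using this
    have h2 : ∀ v, (p.2.1 : (Fin N → Fin 3) → ℂ) v = (q.2.1 : (Fin N → Fin 3) → ℂ) v := fun v => by
      have := congr_fun hpq (Fin.cons a v)
      simpa [hLapply, hE, hab, hac] using this
    have h3 : ∀ v, (p.2.2 : (Fin N → Fin 3) → ℂ) v = (q.2.2 : (Fin N → Fin 3) → ℂ) v := fun v => by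
      have := congr_fun hpq (Fin.cons c v)
      simpa [hLapply, hE, Ne.symm hac, Ne.symm hbc] using this
    exact Prod.ext (Subtype.ext (funext h1))
      (Prod.ext (Subtype.ext (funext h2)) (Subtype.ext (funext h3)))
  have hrange : LinearMap.range L ≤ V := by
    rintro _ ⟨p, rfl⟩
    rw [hLapply]
    obtain ⟨x₁, hx₁⟩ := p.1.2
    obtain ⟨x₂, hx₂⟩ := p.2.1.2
    obtain ⟨x₃, hx₃⟩ := p.2.2.2
    rw [← hx₁, ← hx₂, ← hx₃]
    simp only [Matrix.mulVecLin_apply]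
    rw [hb1, ha1, hc2]
    exact V.add_mem (Submodule.mem_sup_left ⟨_, rfl⟩)
      (V.add_mem (Submodule.mem_sup_left ⟨_, rfl⟩) (Submodule.mem_sup_right ⟨_, rfl⟩))
  have key : Module.finrank ℂ (↥C₁ × (↥C₁ × ↥C₂)) ≤ Module.finrank ℂ ↥V := by
    rw [← LinearMap.finrank_range_of_inj hLinj]
    exact Submodule.finrank_mono hrange
  rw [Module.finrank_prod, Module.finrank_prod] at key
  have hr1 : X₁.rank = Module.finrank ℂ ↥C₁ := rfl
  have hr2 : X₂.rank = Module.finrank ℂ ↥C₂ := rfl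
  omega

end Summit.MatrixMultiplication.MatrixMultiplication.Theorems.OutsiderSandwichPencilSpan
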